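import Literature.Topology.FourManifolds.LickorishWallaceProofs
import Literature.Probability.RandomPlanarGeometry.WholePlaneSLEProofs
import Literature.Probability.RandomPlanarGeometry.WholePlaneLoewnerBackwardMaps
import HarnessLib

/-!
# Whole-plane Loewner chains exist: `WholePlaneLoewnerChain.exists_unique_holds`

Topic `Probability/RandomPlanarGeometry`. Third of the three `…Backward…` files: the discharge of
the named fact `Literature.Probability.RandomPlanarGeometry.WholePlaneLoewnerChain.exists_unique`
of `WholePlaneSLE` — Lawler (2005), Prop. 4.21: for a continuous driving angle `lam` there is a
whole-plane Loewner chain driven by `exp (i lam)`, unique — by assembling the backward-flow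
construction (`WholePlaneLoewnerBackwardFlow`, `…BackwardMaps`) into a `WholePlaneLoewnerChain`
and invoking the uniqueness half `WholePlaneLoewnerChain.exists_unique_of_forall_nonempty` of
`WholePlaneSLEProofs`.

* `WholePlaneLoewner.BackwardFlow.chain hlam : WholePlaneLoewnerChain lam` — Loewner domain
  `D_t = F_t({|w| > 1})` (`loewnerDomain`), hull `K_t = ℂ ∖ D_t` (`loewnerHull`), map
  `g_t = F_t⁻¹` (`loewnerMap`, `Function.invFunOn`), `F_t = invMap lam t`. The axioms: `K_t` is
  compact (`⊆ B̄(0, 4e^t)`), connected — `K_t = ⋂ₙ Cₙ`, `Cₙ = ℂ ∖ F_t({|w| > 1 + 1/(n+1)})` compact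
  and connected (the union of the connected `closure F_t(annulus)` with an open set, closed as a
  whole: `isPreconnected_union_of_isOpen`, properness `exists_nhds_inter_subset`), plus the tree's
  nested-continua lemma `Literature.Topology.FourManifolds.isPreconnected_iInter_of_antitone` —
  with connected complement and containing `0` (`isInteriorHull_loewnerHull`); the hulls increase
  (`loewnerHull_mono`, flow property) and shrink to `{0}` (`iInter_loewnerHull`);
  `g_t : D_t → {|w| > 1}` is a conformal equivalence (`loewnerEquiv`) with `z/g_t(z) → e^t`; the
  Loewner ODE in `t` at fixed `z` (`hasDerivAt_loewnerMap`, by the forward extension of the orbit)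
  and `e^t g_t(z) → z` as `t → -∞` (`tendsto_exp_mul_loewnerMap`).
* `WholePlaneLoewnerChain.exists_unique_holds : WholePlaneLoewnerChain.exists_unique`.

Everything is proved; no named fact is introduced (D-0026); the trust base of
`exists_unique_holds` is Mathlib's three axioms.

## References

* G. F. Lawler, *Conformally Invariant Processes in the Plane*, AMS (2005), §4.3, Prop. 4.21,
  eq. (4.24); §3.2 (compact hulls) [Lawler2005].
-/

noncomputable section

open Set Filter Metric Complex
open scoped Topology NNReal

namespace Literature.Probability.RandomPlanarGeometry

namespace WholePlaneLoewner.BackwardFlow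

/-! ### Two topological lemmas -/

/-- In a preconnected space, the union of a preconnected set `F` and an open set `O` is
preconnected as soon as `F ∪ O` is closed. (If closed sets `u, v` disconnect `F ∪ O` with
`F ⊆ u`, then `(F ∪ O) ∩ v = O ∖ u` is clopen.) [folklore] -/
theorem isPreconnected_union_of_isOpen {X : Type*} [TopologicalSpace X] [PreconnectedSpace X]
    {F O : Set X} (hF : IsPreconnected F) (hO : IsOpen O) (hcl : IsClosed (F ∪ O)) :
    IsPreconnected (F ∪ O) := by
  rw [isPreconnected_iff_subset_of_disjoint_closed]
  -- symmetric core statement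
  have key : ∀ u v : Set X, IsClosed u → IsClosed v → F ∪ O ⊆ u ∪ v → (F ∪ O) ∩ (u ∩ v) = ∅ →
      F ⊆ u → F ∪ O ⊆ u ∨ F ∪ O ⊆ v := by
    intro u v hu hv hcov hdis hFu
    set B := (F ∪ O) ∩ v with hB
    have hBeq : B = O ∩ uᶜ := by
      ext x
      constructor
      · rintro ⟨hx, hxv⟩
        have hxu : x ∉ u := fun hxu ↦ by
          have : x ∈ (F ∪ O) ∩ (u ∩ v) := ⟨hx, hxu, hxv⟩
          rw [hdis] at this
          exact this
        rcases hx with hxF | hxO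
        · exact (hxu (hFu hxF)).elim
        · exact ⟨hxO, hxu⟩
      · rintro ⟨hxO, hxu⟩
        have hx : x ∈ F ∪ O := Or.inr hxO
        rcases hcov hx with h | h
        · exact (hxu h).elim
        · exact ⟨hx, h⟩
    have hBclopen : IsClopen B := ⟨hcl.inter hv, by rw [hBeq]; exact hO.inter hu.isOpen_compl⟩
    rcases isClopen_iff.1 hBclopen with hBe | hBu
    · left
      intro x hx
      rcases hcov hx with h | h
      · exact h
      · have : x ∈ B := ⟨hx, h⟩
        rw [hBe] at this
        exact this.elim
    · right
      intro x _
      have : x ∈ B := by rw [hBu]; trivial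
      exact this.2
  intro u v hu hv hcov hdis
  have hF' : F ⊆ u ∨ F ⊆ v :=
    (isPreconnected_iff_subset_of_disjoint_closed.1 hF) u v hu hv (subset_union_left.trans hcov)
      (subset_empty_iff.1 ((inter_subset_inter_left _ subset_union_left).trans hdis.subset))
  rcases hF' with h | h
  · exact key u v hu hv hcov hdis h
  · have := key v u hv hu (fun x hx ↦ (hcov hx).symm) (by rwa [inter_comm v u]) h
    tauto

/-- The half-open annulus `{1 < |w| ≤ r}` (`r > 1`) is connected: it is the image of the convex
strip `{0 < Re χ ≤ log r}` under `exp`. [folklore] -/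
theorem isConnected_annulus {r : ℝ} (hr : 1 < r) : IsConnected {w : ℂ | 1 < ‖w‖ ∧ ‖w‖ ≤ r} := by
  have heq : {w : ℂ | 1 < ‖w‖ ∧ ‖w‖ ≤ r} = exp '' {χ : ℂ | 0 < χ.re ∧ χ.re ≤ Real.log r} := by
    ext w
    constructor
    · rintro ⟨hw1, hwr⟩
      refine ⟨Complex.log w, ⟨?_, ?_⟩, Complex.exp_log (norm_pos_iff.1 (by linarith))⟩
      · simp only [Complex.log_re]; exact Real.log_pos hw1
      · simp only [Complex.log_re]; exact Real.log_le_log (by linarith) hwr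
    · rintro ⟨χ, ⟨h1, h2⟩, rfl⟩
      refine ⟨by rw [Complex.norm_exp]; exact Real.one_lt_exp_iff.2 h1, ?_⟩
      rw [Complex.norm_exp]
      calc Real.exp χ.re ≤ Real.exp (Real.log r) := Real.exp_le_exp.2 h2
        _ = r := Real.exp_log (by linarith)
  rw [heq]
  have hconv : Convex ℝ {χ : ℂ | 0 < χ.re ∧ χ.re ≤ Real.log r} :=
    (convex_halfSpace_re_gt 0).inter (convex_halfSpace_re_le (Real.log r))
  refine ⟨⟨exp (Real.log r), (Real.log r : ℂ), ⟨by simpa using Real.log_pos hr, by simp⟩, rfl⟩, ?_⟩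
  exact hconv.isPreconnected.image _ Complex.continuous_exp.continuousOn

/-! ### The Loewner domain, hull and map of the backward-flow construction -/

/-- The **Loewner domain** `D_t = f_t({|w| > 1})` of the whole-plane chain (Lawler (2005),
Prop. 4.21: `F_t : ℂ ∖ 𝔻̄ → D_t`). [cite: Lawler2005, §4.3 Prop. 4.21] -/
def loewnerDomain (lam : ℝ → ℝ) (t : ℝ) : Set ℂ := invMap lam t '' exteriorDisc

/-- The **hull** `K_t = ℂ ∖ D_t` of the whole-plane chain. [cite: Lawler2005, §4.3 Prop. 4.21] -/
def loewnerHull (lam : ℝ → ℝ) (t : ℝ) : Set ℂ := (loewnerDomain lam t)ᶜ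

/-- The **whole-plane Loewner map** `g_t = f_t⁻¹ : D_t → {|w| > 1}` (junk off `D_t`).
[cite: Lawler2005, §4.3 Prop. 4.21] -/
def loewnerMap (lam : ℝ → ℝ) (t : ℝ) : ℂ → ℂ := Function.invFunOn (invMap lam t) exteriorDisc

variable {lam : ℝ → ℝ}

/-- Unfolding lemma. [folklore] -/
theorem compl_loewnerHull (lam : ℝ → ℝ) (t : ℝ) : (loewnerHull lam t)ᶜ = loewnerDomain lam t :=
  compl_compl _

/-- `f_t(w) ∈ D_t` for `|w| > 1`. [folklore] -/
theorem invMap_mem_loewnerDomain (t : ℝ) {w : ℂ} (hw : 1 < ‖w‖) : invMap lam t w ∈ loewnerDomain lam t :=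
  mem_image_of_mem _ (mem_exteriorDisc.2 hw)

/-- `g_t(z) ∈ {|w| > 1}` for `z ∈ D_t`. [folklore] -/
theorem one_lt_norm_loewnerMap {t : ℝ} {z : ℂ} (hz : z ∈ loewnerDomain lam t) :
    1 < ‖loewnerMap lam t z‖ :=
  mem_exteriorDisc.1 (Function.invFunOn_mem hz)

/-- `f_t (g_t z) = z` on `D_t`. [folklore] -/
theorem invMap_loewnerMap {t : ℝ} {z : ℂ} (hz : z ∈ loewnerDomain lam t) :
    invMap lam t (loewnerMap lam t z) = z :=
  Function.invFunOn_eq hz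

/-- `g_t (f_t w) = w` for `|w| > 1` (continuous driving angle). [folklore] -/
theorem loewnerMap_invMap (hlam : Continuous lam) (t : ℝ) {w : ℂ} (hw : 1 < ‖w‖) :
    loewnerMap lam t (invMap lam t w) = w :=
  (injOn_invMap hlam t).leftInvOn_invFunOn (mem_exteriorDisc.2 hw)

/-- Characterisation of `g_t`: if `f_t(w) = z` with `|w| > 1` then `g_t(z) = w`. [folklore] -/
theorem loewnerMap_eq_of_invMap_eq (hlam : Continuous lam) {t : ℝ} {w z : ℂ} (hw : 1 < ‖w‖)
    (h : invMap lam t w = z) : loewnerMap lam t z = w := by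
  rw [← h, loewnerMap_invMap hlam t hw]

/-- The Loewner domain is open. [folklore] -/
theorem isOpen_loewnerDomain (hlam : Continuous lam) (t : ℝ) : IsOpen (loewnerDomain lam t) :=
  isOpen_image_invMap hlam t

/-- The hull is closed. [folklore] -/
theorem isClosed_loewnerHull (hlam : Continuous lam) (t : ℝ) : IsClosed (loewnerHull lam t) :=
  (isOpen_loewnerDomain hlam t).isClosed_compl

/-- **The hull lies in `B̄(0, 4e^t)`** (Koebe at infinity). [cite: Lawler2005, §4.3 Prop. 4.21] -/
theorem loewnerHull_subset_closedBall (hlam : Continuous lam) (t : ℝ) :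
    loewnerHull lam t ⊆ closedBall 0 (4 * Real.exp t) := by
  intro z hz
  rw [mem_closedBall_zero_iff]
  by_contra h
  push Not at h
  exact hz (mem_image_invMap_of_lt hlam t h)

/-- The hull is compact. [folklore] -/
theorem isCompact_loewnerHull (hlam : Continuous lam) (t : ℝ) : IsCompact (loewnerHull lam t) :=
  Metric.isCompact_of_isClosed_isBounded (isClosed_loewnerHull hlam t)
    (isBounded_closedBall.subset (loewnerHull_subset_closedBall hlam t))

/-- The origin is in every hull (`f_t ≠ 0`). [folklore] -/
theorem zero_mem_loewnerHull (lam : ℝ → ℝ) (t : ℝ) : (0 : ℂ) ∈ loewnerHull lam t := by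
  rintro ⟨w, -, hw⟩
  exact invMap_ne_zero lam t w hw

/-- The Loewner domain is connected. [folklore] -/
theorem isConnected_loewnerDomain (hlam : Continuous lam) (t : ℝ) : IsConnected (loewnerDomain lam t) := by
  have hc : IsConnected exteriorDisc := ⟨⟨2, by simp [mem_exteriorDisc]⟩, isPreconnected_exteriorDisc⟩
  exact hc.image _ (continuousOn_invMap hlam t)

/-- `g_t` is holomorphic on `D_t`. [folklore] -/
theorem differentiableOn_loewnerMap (hlam : Continuous lam) (t : ℝ) :
    DifferentiableOn ℂ (loewnerMap lam t) (loewnerDomain lam t) :=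
  Complex.differentiableOn_invFunOn_image isOpen_exteriorDisc (differentiableOn_invMap hlam t)
    (injOn_invMap hlam t) fun _ hw ↦ deriv_invMap_ne_zero hlam t hw

/-- **`g_t : D_t → {|w| > 1}` is a conformal equivalence** with inverse `f_t`. Lawler (2005),
Prop. 4.21. [cite: Lawler2005, §4.3 Prop. 4.21] -/
def loewnerEquiv (hlam : Continuous lam) (t : ℝ) : ConformalEquiv (loewnerHull lam t)ᶜ exteriorDisc where
  toFun := loewnerMap lam t
  invFun := invMap lam t
  source := (loewnerHull lam t)ᶜ
  target := exteriorDisc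
  map_source' z hz := Function.invFunOn_mem (by rwa [compl_loewnerHull] at hz)
  map_target' w hw := by rw [compl_loewnerHull]; exact mem_image_of_mem _ hw
  left_inv' z hz := invMap_loewnerMap (by rwa [compl_loewnerHull] at hz)
  right_inv' w hw := loewnerMap_invMap hlam t (mem_exteriorDisc.1 hw)
  source_eq := rfl
  target_eq := rfl
  differentiableOn := by rw [compl_loewnerHull]; exact differentiableOn_loewnerMap hlam t
  differentiableOn_symm := differentiableOn_invMap hlam t

/-! ### The hull is connected -/

/-- **Properness of `g_t` at the boundary.** A point `y ∉ D_t` has a neighbourhood whose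
intersection with `D_t` lies in the image of the thin annulus `{1 < |w| ≤ r}` (`r > 1`):
`|g_t(z)| → 1` as `z → ∂D_t`. [folklore] -/
theorem exists_nhds_inter_subset (hlam : Continuous lam) (t : ℝ) {r : ℝ} (hr : 1 < r) {y : ℂ}
    (hy : y ∉ loewnerDomain lam t) :
    ∃ N ∈ 𝓝 y, N ∩ loewnerDomain lam t ⊆ invMap lam t '' {w : ℂ | 1 < ‖w‖ ∧ ‖w‖ ≤ r} := by
  -- a radius `R` beyond which images are far from `y`
  set R : ℝ := max (max r 2) (Real.exp (6 - t) * (‖y‖ + 1) + 1) with hR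
  have hRr : r ≤ R := (le_max_left r 2).trans (le_max_left _ _)
  have hR2 : 2 ≤ R := (le_max_right r 2).trans (le_max_left _ _)
  have hRfar : Real.exp (6 - t) * (‖y‖ + 1) < R := lt_of_lt_of_le (by linarith) (le_max_right _ _)
  -- images of `{|w| ≥ R}` have norm `> |y| + 1`
  have hfar : ∀ w : ℂ, R ≤ ‖w‖ → ‖y‖ + 1 < ‖invMap lam t w‖ := by
    intro w hw
    have hw1 : 1 < ‖w‖ := by linarith
    have hM : errConst w ≤ 6 := by
      rw [← errConst_two]; exact errConst_anti (by simp) (by simpa using hR2.trans hw)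
    have hlow := le_norm_invMap (t := t) hlam hw1
    have h1 : Real.exp t * ‖w‖ * Real.exp (-6) ≤ Real.exp t * ‖w‖ * Real.exp (-errConst w) :=
      mul_le_mul_of_nonneg_left (Real.exp_le_exp.2 (by linarith)) (by positivity)
    have h2 : ‖y‖ + 1 < Real.exp t * R * Real.exp (-6) := by
      have : (‖y‖ + 1) = Real.exp t * (Real.exp (6 - t) * (‖y‖ + 1)) * Real.exp (-6) := by
        rw [show (6 : ℝ) - t = 6 + -t by ring, Real.exp_add, Real.exp_neg t, Real.exp_neg 6]
        field_simp
      rw [this]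
      gcongr
    have h3 : Real.exp t * R * Real.exp (-6) ≤ Real.exp t * ‖w‖ * Real.exp (-6) := by gcongr
    linarith
  -- the compact piece `f_t({r ≤ |w| ≤ R})` misses `y`
  set P : Set ℂ := invMap lam t '' {w : ℂ | r ≤ ‖w‖ ∧ ‖w‖ ≤ R} with hP
  have hPc : IsCompact P := by
    have hcpt : IsCompact {w : ℂ | r ≤ ‖w‖ ∧ ‖w‖ ≤ R} := by
      have : {w : ℂ | r ≤ ‖w‖ ∧ ‖w‖ ≤ R} = closedBall 0 R ∩ {w | r ≤ ‖w‖} := by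
        ext w; simp [and_comm]
      rw [this]
      exact (isCompact_closedBall 0 R).inter_right (isClosed_le continuous_const continuous_norm)
    refine hcpt.image_of_continuousOn ((continuousOn_invMap hlam t).mono ?_)
    intro w hw
    exact mem_exteriorDisc.2 (hr.trans_le hw.1)
  have hyP : y ∉ P := by
    rintro ⟨w, hw, rfl⟩
    exact hy (invMap_mem_loewnerDomain t (hr.trans_le hw.1))
  refine ⟨Pᶜ ∩ ball y 1, inter_mem (hPc.isClosed.isOpen_compl.mem_nhds hyP) (ball_mem_nhds y one_pos), ?_⟩
  rintro z ⟨⟨hzP, hzy⟩, ⟨w, hw, rfl⟩⟩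
  have hw1 : 1 < ‖w‖ := mem_exteriorDisc.1 hw
  refine ⟨w, ⟨hw1, ?_⟩, rfl⟩
  by_contra hwr
  push Not at hwr
  rcases le_or_gt ‖w‖ R with hwR | hwR
  · exact hzP ⟨w, ⟨hwr.le, hwR⟩, rfl⟩
  · have h1 := hfar w hwR.le
    rw [mem_ball, dist_eq_norm] at hzy
    have h2 : ‖invMap lam t w‖ ≤ ‖invMap lam t w - y‖ + ‖y‖ := norm_le_norm_sub_add _ _
    linarith

/-- The auxiliary sets `C_r = ℂ ∖ f_t({|w| > r})`, `r > 1`, are compact and connected, and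
`K_t = ⋂ C_r`. Compactness. [folklore] -/
theorem isCompact_compl_image (hlam : Continuous lam) (t : ℝ) {r : ℝ} (hr : 1 < r) :
    IsCompact (invMap lam t '' {w : ℂ | r < ‖w‖})ᶜ := by
  have hopen : IsOpen (invMap lam t '' {w : ℂ | r < ‖w‖}) := by
    have hsub : {w : ℂ | r < ‖w‖} ⊆ exteriorDisc := fun w hw ↦ mem_exteriorDisc.2 (hr.trans hw)
    exact Complex.isOpen_image_of_deriv_ne_zero (isOpen_lt continuous_const continuous_norm)
      ((differentiableOn_invMap hlam t).mono hsub) fun w hw ↦ deriv_invMap_ne_zero hlam t (hsub hw)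
  refine Metric.isCompact_of_isClosed_isBounded hopen.isClosed_compl
    ((isBounded_closedBall (x := (0 : ℂ)) (r := 4 * r * Real.exp t)).subset ?_)
  intro z hz
  rw [mem_closedBall_zero_iff]
  by_contra h
  push Not at h
  have hr0 : 0 < r := by linarith
  have h4 : 4 * Real.exp t < ‖z‖ := lt_of_le_of_lt (by nlinarith [Real.exp_pos t]) h
  obtain ⟨w, hw, rfl⟩ := mem_image_invMap_of_lt hlam t h4
  have hw1 := mem_exteriorDisc.1 hw
  apply hz
  refine ⟨w, ?_, rfl⟩
  by_contra hwr
  simp only [mem_setOf_eq, not_lt] at hwr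
  have := norm_invMap_le_of_norm_le hlam t hw1 hwr
  linarith

/-- Connectedness of `C_r = ℂ ∖ f_t({|w| > r})`: it is the union of the connected set
`closure f_t({1 < |w| ≤ r})` and an open set (points of the hull away from that closure are
interior, by properness), and it is closed. [folklore] -/
theorem isPreconnected_compl_image (hlam : Continuous lam) (t : ℝ) {r : ℝ} (hr : 1 < r) :
    IsPreconnected (invMap lam t '' {w : ℂ | r < ‖w‖})ᶜ := by
  set C : Set ℂ := (invMap lam t '' {w : ℂ | r < ‖w‖})ᶜ with hC
  set S : Set ℂ := invMap lam t '' {w : ℂ | 1 < ‖w‖ ∧ ‖w‖ ≤ r} with hS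
  have hCcl : IsClosed C := (isCompact_compl_image hlam t hr).isClosed
  -- `S ⊆ C` (injectivity), hence `closure S ⊆ C`
  have hSC : S ⊆ C := by
    rintro _ ⟨w, hw, rfl⟩ ⟨w', hw', heq⟩
    have := injOn_invMap hlam t (mem_exteriorDisc.2 (hr.trans hw')) (mem_exteriorDisc.2 hw.1) heq
    rw [this] at hw'
    exact absurd hw.2 (not_le.2 hw')
  have hclS : closure S ⊆ C := closure_minimal hSC hCcl
  -- `C ⊆ K ∪ S` and `C ∖ closure S` is open
  have hCsub : ∀ z ∈ C, z ∈ loewnerDomain lam t → z ∈ S := by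
    rintro z hz ⟨w, hw, rfl⟩
    refine ⟨w, ⟨mem_exteriorDisc.1 hw, ?_⟩, rfl⟩
    by_contra h
    exact hz ⟨w, not_le.1 h, rfl⟩
  have hopen : IsOpen (C \ closure S) := by
    rw [isOpen_iff_mem_nhds]
    rintro x ⟨hxC, hxS⟩
    have hxD : x ∉ loewnerDomain lam t := fun hxD ↦ hxS (subset_closure (hCsub x hxC hxD))
    obtain ⟨N, hN, hNsub⟩ := exists_nhds_inter_subset hlam t hr hxD
    have hN' : (closure S)ᶜ ∈ 𝓝 x := isClosed_closure.isOpen_compl.mem_nhds hxS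
    filter_upwards [hN, hN'] with z hzN hzS
    refine ⟨?_, hzS⟩
    -- `z ∈ C`: if `z = f w` with `|w| > r` then `z ∈ N ∩ D ⊆ S ⊆ closure S`, contradiction
    rintro ⟨w, hw, rfl⟩
    have hzD : invMap lam t w ∈ loewnerDomain lam t := invMap_mem_loewnerDomain t (hr.trans hw)
    exact hzS (subset_closure (hNsub ⟨hzN, hzD⟩))
  -- `C = closure S ∪ (C ∖ closure S)`
  have hCeq : C = closure S ∪ (C \ closure S) := by
    rw [union_sdiff_cancel hclS]
  rw [hCeq]
  refine isPreconnected_union_of_isOpen ?_ hopen (by rw [← hCeq]; exact hCcl)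
  exact ((isConnected_annulus hr).image _ ((continuousOn_invMap hlam t).mono fun w hw ↦
    mem_exteriorDisc.2 hw.1)).isPreconnected.closure

/-- **The hull `K_t` is connected.** [cite: Lawler2005, §4.3 Prop. 4.21] -/
theorem isConnected_loewnerHull (hlam : Continuous lam) (t : ℝ) : IsConnected (loewnerHull lam t) := by
  refine ⟨⟨0, zero_mem_loewnerHull lam t⟩, ?_⟩
  set D : ℕ → Set ℂ := fun n ↦ (invMap lam t '' {w : ℂ | 1 + 1 / ((n : ℝ) + 1) < ‖w‖})ᶜ with hD
  have hr : ∀ n : ℕ, (1 : ℝ) < 1 + 1 / ((n : ℝ) + 1) := fun n ↦ by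
    have : (0 : ℝ) < 1 / ((n : ℝ) + 1) := by positivity
    linarith
  have hanti : Antitone D := by
    intro n m hnm
    simp only [hD]
    refine compl_subset_compl.2 (image_mono fun w hw ↦ ?_)
    simp only [mem_setOf_eq] at hw ⊢
    have : 1 / ((m : ℝ) + 1) ≤ 1 / ((n : ℝ) + 1) :=
      one_div_le_one_div_of_le (by positivity) (by exact_mod_cast Nat.succ_le_succ hnm)
    linarith
  have heq : loewnerHull lam t = ⋂ n, D n := by
    ext z
    simp only [loewnerHull, loewnerDomain, mem_compl_iff, mem_iInter, hD]
    constructor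
    · rintro hz n ⟨w, hw, rfl⟩
      exact hz ⟨w, mem_exteriorDisc.2 ((hr n).trans hw), rfl⟩
    · rintro hz ⟨w, hw, rfl⟩
      have hw1 := mem_exteriorDisc.1 hw
      -- pick `n` with `1 + 1/(n+1) < |w|`
      obtain ⟨n, hn⟩ := exists_nat_gt (1 / (‖w‖ - 1))
      refine hz n ⟨w, ?_, rfl⟩
      simp only [mem_setOf_eq]
      have hpos : 0 < ‖w‖ - 1 := by linarith
      have h1 : 1 / ((n : ℝ) + 1) < ‖w‖ - 1 := by
        rw [div_lt_iff₀ (by positivity)]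
        rw [div_lt_iff₀ hpos] at hn
        nlinarith
      linarith
  rw [heq]
  exact Literature.Topology.FourManifolds.isPreconnected_iInter_of_antitone hanti
    (fun n ↦ isCompact_compl_image hlam t (hr n)) fun n ↦ isPreconnected_compl_image hlam t (hr n)

/-- **`K_t` is an interior hull**: compact, connected, with connected complement.
[cite: Lawler2005, §4.3 Prop. 4.21] -/
theorem isInteriorHull_loewnerHull (hlam : Continuous lam) (t : ℝ) : IsInteriorHull (loewnerHull lam t) :=
  ⟨isCompact_loewnerHull hlam t, isConnected_loewnerHull hlam t, by
    rw [compl_loewnerHull]; exact isConnected_loewnerDomain hlam t⟩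

/-! ### Monotonicity, the ODE in `t`, and the behaviour at `-∞` -/

/-- **The Loewner domains decrease** (the hulls increase): `D_t ⊆ D_s` for `s ≤ t`, by the flow
property `f_s(u_s(w)) = f_t(w)`. [folklore] -/
theorem loewnerDomain_subset (hlam : Continuous lam) {s t : ℝ} (hst : s ≤ t) :
    loewnerDomain lam t ⊆ loewnerDomain lam s := by
  rintro _ ⟨w, hw, rfl⟩
  have hw1 := mem_exteriorDisc.1 hw
  rw [← invMap_orbit hlam hw1 hst]
  exact invMap_mem_loewnerDomain s (one_lt_norm_orbit hlam hw1 hst)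

/-- The hulls increase. [folklore] -/
theorem loewnerHull_mono (hlam : Continuous lam) : Monotone (loewnerHull lam) := fun _ _ hst ↦
  compl_subset_compl.2 (loewnerDomain_subset hlam hst)

/-- Every `z ≠ 0` lies in `D_t` for `t` negative enough (`t = log (|z|/5)`). [folklore] -/
theorem mem_loewnerDomain_log (hlam : Continuous lam) {z : ℂ} (hz : z ≠ 0) :
    z ∈ loewnerDomain lam (Real.log (‖z‖ / 5)) := by
  have hzpos : 0 < ‖z‖ := norm_pos_iff.2 hz
  refine mem_image_invMap_of_lt hlam _ ?_
  rw [Real.exp_log (by positivity)]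
  linarith

/-- **The hulls shrink to the origin**: `⋂ₜ K_t = {0}`. [cite: Lawler2005, §4.3 Prop. 4.21] -/
theorem iInter_loewnerHull (hlam : Continuous lam) : ⋂ t, loewnerHull lam t = {0} := by
  refine Subset.antisymm ?_ (singleton_subset_iff.2 (mem_iInter.2 (zero_mem_loewnerHull lam)))
  intro z hz
  rw [mem_iInter] at hz
  by_contra hz0
  exact hz (Real.log (‖z‖ / 5)) (mem_loewnerDomain_log hlam hz0)

/-- **The Loewner map along a trajectory.** For `z ∈ D_t` and `w = g_t(z)` there is `ε > 0`
such that for every `s ≤ t + ε`: `z ∈ D_s` and `g_s(z) = orbit t w s` (the trajectory through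
`(t, w)`, extended a little beyond `t`). [folklore] -/
theorem exists_loewnerMap_eq_orbit (hlam : Continuous lam) {t : ℝ} {z : ℂ} (hz : z ∈ loewnerDomain lam t) :
    ∃ ε > 0, ∀ s ≤ t + ε, z ∈ loewnerDomain lam s ∧
      loewnerMap lam s z = orbit lam t (loewnerMap lam t z) s ∧
      HasDerivAt (orbit lam t (loewnerMap lam t z)) (field lam s (orbit lam t (loewnerMap lam t z) s)) s := by
  set w := loewnerMap lam t z with hw
  have hw1 : 1 < ‖w‖ := one_lt_norm_loewnerMap hz
  have hzw : invMap lam t w = z := invMap_loewnerMap hz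
  obtain ⟨ε, hε, -, hsol⟩ := exists_forward hlam (t := t) hw1
  refine ⟨ε, hε, fun s hs ↦ ?_⟩
  have hkey : invMap lam s (orbit lam t w s) = z := by
    rcases le_or_gt s t with hst | hst
    · rw [invMap_orbit hlam hw1 hst, hzw]
    · rw [invMap_orbit_of_forward hlam hw1 hst.le (fun r hr ↦ hsol r (hr.trans hs)), hzw]
  have hn : 1 < ‖orbit lam t w s‖ := (hsol s hs).2
  exact ⟨hkey ▸ invMap_mem_loewnerDomain s hn, loewnerMap_eq_of_invMap_eq hlam hn hkey, (hsol s hs).1⟩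

/-- **The whole-plane Loewner equation in `t`**: for `z ∉ K_t`,
`∂ₛ g_s(z)|_{s=t} = g_t(z) (W_t + g_t(z))/(W_t - g_t(z))`. Lawler (2005), (4.24). [cite: Lawler2005, §4.3 eq. (4.24)] -/
theorem hasDerivAt_loewnerMap (hlam : Continuous lam) {t : ℝ} {z : ℂ} (hz : z ∉ loewnerHull lam t) :
    HasDerivAt (fun s ↦ loewnerMap lam s z) (field lam t (loewnerMap lam t z)) t := by
  have hz' : z ∈ loewnerDomain lam t := not_notMem.1 hz
  obtain ⟨ε, hε, h⟩ := exists_loewnerMap_eq_orbit hlam hz'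
  have hev : (fun s ↦ loewnerMap lam s z) =ᶠ[𝓝 t] orbit lam t (loewnerMap lam t z) := by
    filter_upwards [Iio_mem_nhds (by linarith : t < t + ε)] with s hs using (h s hs.le).2.1
  have hd := (h t (by linarith)).2.2
  rw [orbit_self hlam (one_lt_norm_loewnerMap hz')] at hd
  exact hd.congr_of_eventuallyEq hev

/-- **Asymptotic initial value**: `e^t g_t(z) → z` as `t → -∞`, for `z ≠ 0`. Lawler (2005),
Prop. 4.21 (`g_t(z) ∼ e^{-t} z`). [cite: Lawler2005, §4.3 Prop. 4.21] -/
theorem tendsto_exp_mul_loewnerMap (hlam : Continuous lam) {z : ℂ} (hz : z ≠ 0) :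
    Tendsto (fun t ↦ (Real.exp t : ℂ) * loewnerMap lam t z) atBot (𝓝 z) := by
  set t₀ := Real.log (‖z‖ / 5) with ht₀
  have hz₀ : z ∈ loewnerDomain lam t₀ := mem_loewnerDomain_log hlam hz
  set w₀ := loewnerMap lam t₀ z with hw₀
  have hw₀ : 1 < ‖w₀‖ := one_lt_norm_loewnerMap hz₀
  have hzw₀ : invMap lam t₀ w₀ = z := invMap_loewnerMap hz₀
  obtain ⟨ε, hε, h⟩ := exists_loewnerMap_eq_orbit hlam hz₀
  have hlim := tendsto_exp_mul_orbit (t := t₀) hlam hw₀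
  rw [hzw₀] at hlim
  refine hlim.congr' ?_
  filter_upwards [eventually_le_atBot t₀] with s hs
  rw [(h s (by linarith)).2.1]

/-! ### The whole-plane Loewner chain driven by `exp (i lam)` -/

/-- **The whole-plane Loewner chain driven by `exp (i · lam)`** for a continuous driving angle
(existence half of Lawler (2005), Prop. 4.21): hulls `K_t = ℂ ∖ f_t({|w| > 1})`, maps
`g_t = f_t⁻¹`, `f_t = lim_{s → -∞} e^s u_s`. [cite: Lawler2005, §4.3 Prop. 4.21] -/
def chain (hlam : Continuous lam) : WholePlaneLoewnerChain lam where
  hull := loewnerHull lam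
  map := loewnerMap lam
  isInteriorHull := isInteriorHull_loewnerHull hlam
  zero_mem := zero_mem_loewnerHull lam
  hull_mono := loewnerHull_mono hlam
  iInter_hull := iInter_loewnerHull hlam
  exists_conformalEquiv t := ⟨loewnerEquiv hlam t, fun _ _ ↦ rfl⟩
  capacity t := by
    rw [compl_loewnerHull]
    exact tendsto_div_invFunOn_invMap hlam t
  hasDerivAt _ _ hz := hasDerivAt_loewnerMap hlam hz
  tendsto_atBot _ hz := tendsto_exp_mul_loewnerMap hlam hz

end WholePlaneLoewner.BackwardFlow

/-! ### The named fact -/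

/-- **`WholePlaneLoewnerChain.exists_unique` holds** (Lawler (2005), Prop. 4.21): for every
continuous driving angle there is a whole-plane Loewner chain driven by `exp (i · lam)` — the
backward-flow construction `WholePlaneLoewner.BackwardFlow.chain` of this file — and any two such
chains have the same hulls and the same maps off the hulls (`WholePlaneLoewnerChain.unique` of
`WholePlaneSLEProofs`, whence `WholePlaneLoewnerChain.exists_unique_of_forall_nonempty`).
[cite: Lawler2005, §4.3 Prop. 4.21] -/
theorem WholePlaneLoewnerChain.exists_unique_holds : WholePlaneLoewnerChain.exists_unique :=
  WholePlaneLoewnerChain.exists_unique_of_forall_nonempty fun _ hlam ↦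
    ⟨WholePlaneLoewner.BackwardFlow.chain hlam⟩

end Literature.Probability.RandomPlanarGeometry
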